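import Mathlib
import HarnessLib

/-!
# Route `KolyvaginDepthDoor`, crux `KolyvaginDepthSupplyKN` (stmt-BirchSwinnertonDyer-22820) —
# DEPTH TABLE v27, KIT 2/3: a kernel-checkable UNIQUENESS CERTIFICATE for sparse integer linear systems
# («the solution space is the line through `φ`»)

Helper file of the lead prover of line `levelone` (kdd-p1 g31; `--supports stmt-BirchSwinnertonDyer-22820
--as helper`); it closes nothing and BSD is NOT proved by it. Pure linear algebra, no modular forms.

SETTING. Unknowns `F : ℕ → ℝ` (indices `< X` matter), a pool of sparse integer equations `gen k`
(`k < K`; an equation is a list of pairs `(index, coefficient)`, read `∑ c · F(index) = 0`), and an integer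
vector `φ` satisfying the pool. A certificate `C : Cert` consists of CORE indices `c₀, …, c_{m-1}`, for
every index `j` an integer EXPRESSION vector `E_j ∈ ℤ^m`, a list of PEELING steps `(k, j)` («equation `k`
determines the new unknown `j`, with coefficient `±1`, from already determined ones, and `E_j` is the
induced expression»), `m - 1` CORE equations, and a matrix `B` with `A'B ≡ 1 (mod q)`, `A'` the core
equations written in core coordinates with the `c₀`-column deleted. `check gen K X φ C = true` is decided
by the kernel; `exists_eq_smul_of_check` concludes: every real solution of the pool agrees on `{0,…,X-1}`
with `λ · φ` for one real `λ`. (Soundness: peeling expresses every unknown in the core unknowns; for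
`G = F - (F c₀/φ c₀) φ` the core equations read `A' y = 0`, `y = (G c₁, …, G c_{m-1})`, and
`det A' ≢ 0 (mod q)` forces `y = 0`.)

References: [CremonaAlgorithms1997] §2.2–2.5 (the linear algebra of M-symbols); standard.
-/

set_option linter.dupNamespace false

namespace Summit.BirchSwinnertonDyer.BirchSwinnertonDyer.Theorems.KolyvaginDepthDoor.MSymbolCert

/-! ## §1 Sparse equations -/

/-- A sparse integer linear form: a list of `(index, coefficient)`; read `∑ c · F(index)`. [folklore] -/
abbrev Eqn : Type := List (ℕ × ℤ)

/-- Evaluation `∑_{(j,c) ∈ e} c · F j` of a sparse form at a real vector. [folklore] -/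
def eval (F : ℕ → ℝ) : Eqn → ℝ
  | [] => 0
  | (j, c) :: e => (c : ℝ) * F j + eval F e

/-- Integer evaluation `∑ c · φ j` (the kernel's check that `φ` solves an equation). [folklore] -/
def evalInt (φ : ℕ → ℤ) : Eqn → ℤ
  | [] => 0
  | (j, c) :: e => c * φ j + evalInt φ e

/-- `eval` at an integer vector is the cast of `evalInt`. [folklore] -/
theorem eval_intCast (φ : ℕ → ℤ) (e : Eqn) : eval (fun j => (φ j : ℝ)) e = (evalInt φ e : ℝ) := by
  induction e with
  | nil => simp [eval, evalInt]
  | cons jc e ih => obtain ⟨j, c⟩ := jc; simp [eval, evalInt, ih]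

/-- `eval` is linear: `eval (F - λ φ) = eval F - λ eval φ`. [folklore] -/
theorem eval_sub_smul (F G : ℕ → ℝ) (t : ℝ) (e : Eqn) :
    eval (fun j => F j - t * G j) e = eval F e - t * eval G e := by
  induction e with
  | nil => simp [eval]
  | cons jc e ih => obtain ⟨j, c⟩ := jc; simp only [eval, ih]; ring

/-- The total coefficient of the index `j` in `e`. [folklore] -/
def coefAt (e : Eqn) (j : ℕ) : ℤ := match e with
  | [] => 0
  | (j', c) :: e => (if j' = j then c else 0) + coefAt e j

/-- `e` with the index `j` removed. [folklore] -/
def rest (e : Eqn) (j : ℕ) : Eqn := e.filter (fun jc => jc.1 ≠ j)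

/-- Splitting off one unknown: `eval F e = (coefAt e j) F j + eval F (rest e j)`. [folklore] -/
theorem eval_eq_coefAt_add (F : ℕ → ℝ) (e : Eqn) (j : ℕ) :
    eval F e = (coefAt e j : ℝ) * F j + eval F (rest e j) := by
  induction e with
  | nil => simp [eval, coefAt, rest]
  | cons jc e ih =>
    obtain ⟨j', c⟩ := jc
    by_cases h : j' = j
    · subst h
      simp only [eval, coefAt, rest, ne_eq, not_true_eq_false, decide_false, Bool.false_eq_true,
        not_false_eq_true, List.filter_cons_of_neg, ↓reduceIte, Int.cast_add] at ih ⊢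
      rw [ih]; ring
    · simp only [eval, coefAt, rest, ne_eq, h, not_false_eq_true, decide_true, List.filter_cons_of_pos,
        ↓reduceIte, zero_add] at ih ⊢
      rw [ih]; ring

/-! ## §2 Certificates and the checker -/

/-- A uniqueness certificate (see the module docstring). [folklore] -/
structure Cert where
  /-- number of core unknowns -/
  m : ℕ
  /-- the core indices `c₀, …, c_{m-1}` (`c₀` the pivot) -/
  core : List ℕ
  /-- expression vectors: `expr[j] = E_j ∈ ℤ^m` -/
  expr : List (List ℤ)
  /-- peeling steps `(equation code, new unknown)` -/
  steps : List (ℕ × ℕ)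
  /-- the `m - 1` core equation codes -/
  coreEqs : List ℕ
  /-- modulus of the rank certificate -/
  q : ℕ
  /-- `(m-1) × (m-1)` matrix with `A' · binv ≡ 1 (mod q)` -/
  binv : List (List ℕ)

namespace Cert

variable (C : Cert)

/-- `E_j[k]`. [folklore] -/
def ex (j k : ℕ) : ℤ := (C.expr.getD j []).getD k 0

/-- `c_k`. [folklore] -/
def cr (k : ℕ) : ℕ := C.core.getD k 0

/-- `∑_{(j,c) ∈ L} c · E_j[k]`: a sparse form rewritten in core coordinates. [folklore] -/
def comb (L : Eqn) (k : ℕ) : ℤ := match L with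
  | [] => 0
  | (j, c) :: L => c * C.ex j k + comb L k

/-- One peeling step is valid: equation `e` has coefficient `±1` at the new unknown `j`, every other unknown
of `e` is known, and `E_j = -c_j · ∑_{rest} c E_{j'}`. [folklore] -/
def stepOK (known : List ℕ) (e : Eqn) (j : ℕ) : Bool :=
  (coefAt e j == 1 || coefAt e j == -1) &&
    (rest e j).all (fun jc => decide (jc.1 ∈ known)) &&
    (List.range C.m).all (fun k => C.ex j k == -(coefAt e j) * C.comb (rest e j) k)

/-- Peeling: process the steps, growing the list of known unknowns; `none` on failure. [folklore] -/
def peel (gen : ℕ → Eqn) : List ℕ → List (ℕ × ℕ) → Option (List ℕ)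
  | known, [] => some known
  | known, (code, j) :: steps =>
    if C.stepOK known (gen code) j then peel gen (j :: known) steps else none

/-- Entry `(r, t)` of `A'`: core equation `r` in core coordinates, column `t + 1`. [folklore] -/
def aEntry (gen : ℕ → Eqn) (r t : ℕ) : ℤ := C.comb (gen (C.coreEqs.getD r 0)) (t + 1)

/-- Entry `(t, s)` of `B`. [folklore] -/
def bEntry (t s : ℕ) : ℤ := ((C.binv.getD t []).getD s 0 : ℕ)

/-- `(A' B)_{r s}` as an integer. [folklore] -/
def abEntry (gen : ℕ → Eqn) (r s : ℕ) : ℤ :=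
  ((List.range (C.m - 1)).map fun t => C.aEntry gen r t * C.bEntry t s).sum

/-- The full check: core unit vectors, peeling from the core covering `{0, …, X-1}`, every used equation
code `< K` with all its unknowns known, `A' B ≡ 1 (mod q)`, `q > 1`, `φ` solves the pool, `φ(c₀) ≠ 0`.
[folklore] -/
def check (gen : ℕ → Eqn) (K X : ℕ) (φ : ℕ → ℤ) : Bool :=
  decide (0 < C.m) && decide (1 < C.q) && decide (C.coreEqs.length = C.m - 1) &&
  decide (C.core.length = C.m) &&
  -- core expressions are the unit vectors
  (List.range C.m).all (fun k => (List.range C.m).all fun k' =>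
    C.ex (C.cr k) k' == if k = k' then 1 else 0) &&
  -- codes in range
  C.steps.all (fun s => decide (s.1 < K)) && C.coreEqs.all (fun k => decide (k < K)) &&
  -- peeling succeeds and covers everything; core equations use known unknowns only
  (match C.peel gen C.core C.steps with
    | none => false
    | some known => (List.range X).all (fun i => decide (i ∈ known)) &&
        C.coreEqs.all (fun k => (gen k).all fun jc => decide (jc.1 ∈ known))) &&
  -- A' B ≡ 1 mod q
  (List.range (C.m - 1)).all (fun r => (List.range (C.m - 1)).all fun s =>
    C.abEntry gen r s % (C.q : ℤ) == if r = s then 1 else 0) &&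
  -- φ solves the pool and is non-zero at the pivot
  (List.range K).all (fun k => evalInt φ (gen k) == 0) && (φ (C.cr 0) != 0)

end Cert

/-! ## §3 Soundness -/

section Sound

variable (C : Cert) (gen : ℕ → Eqn)

/-- The expression of the unknown `j` in core coordinates, `∑_{k<m} E_j[k] · F(c_k)`; «`j` is expressed»
means `F j = exprSum C F j`. [folklore] -/
def exprSum (F : ℕ → ℝ) (j : ℕ) : ℝ := ∑ k ∈ Finset.range C.m, (C.ex j k : ℝ) * F (C.cr k)

/-- A sparse form all of whose unknowns are expressed evaluates through `comb`. [folklore] -/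
theorem eval_eq_sum_comb (F : ℕ → ℝ) (L : Eqn) (hL : ∀ jc ∈ L, F jc.1 = exprSum C F jc.1) :
    eval F L = ∑ k ∈ Finset.range C.m, (C.comb L k : ℝ) * F (C.cr k) := by
  induction L with
  | nil => simp [eval, Cert.comb]
  | cons jc L ih =>
    obtain ⟨j, c⟩ := jc
    have hj : F j = exprSum C F j := hL (j, c) (by simp)
    have ih' := ih (fun jc hjc => hL jc (by simp [hjc]))
    simp only [eval, Cert.comb, Int.cast_add, Int.cast_mul]
    rw [ih', hj, exprSum, Finset.mul_sum, ← Finset.sum_add_distrib]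
    refine Finset.sum_congr rfl fun k _ => ?_
    ring

/-- Soundness of one peeling step. [folklore] -/
theorem expressed_of_stepOK (F : ℕ → ℝ) (known : List ℕ) (e : Eqn) (j : ℕ)
    (hstep : C.stepOK known e j = true) (hknown : ∀ j' ∈ known, F j' = exprSum C F j') (he : eval F e = 0) :
    F j = exprSum C F j := by
  simp only [Cert.stepOK, Bool.and_eq_true, Bool.or_eq_true, beq_iff_eq, List.all_eq_true,
    decide_eq_true_eq, List.mem_range] at hstep
  obtain ⟨⟨hc, hrest⟩, hex⟩ := hstep
  have hsplit := eval_eq_coefAt_add F e j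
  have hrest' : ∀ jc ∈ rest e j, F jc.1 = exprSum C F jc.1 := fun jc hjc => hknown _ (hrest jc hjc)
  rw [he, eval_eq_sum_comb C F _ hrest'] at hsplit
  -- `F j = -(coefAt) * ∑ comb * F c` since coefAt = ±1
  have hcu : (coefAt e j : ℝ) * (coefAt e j : ℝ) = 1 := by
    rcases hc with h | h <;> simp [h]
  have hFj : F j = -(coefAt e j : ℝ) * ∑ k ∈ Finset.range C.m, (C.comb (rest e j) k : ℝ) * F (C.cr k) := by
    have := congrArg (fun x => (coefAt e j : ℝ) * x) hsplit
    simp only [mul_zero, mul_add, ← mul_assoc, hcu, one_mul] at this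
    linarith
  rw [exprSum, hFj, Finset.mul_sum]
  refine Finset.sum_congr rfl fun k hk => ?_
  rw [hex k (Finset.mem_range.mp hk)]
  push_cast
  ring

/-- Soundness of peeling: if every known unknown is expressed and `F` solves the used equations, then
every finally-known unknown is expressed. [folklore] -/
theorem expressed_of_peel (F : ℕ → ℝ) (K : ℕ) (hF : ∀ k < K, eval F (gen k) = 0) :
    ∀ (steps : List (ℕ × ℕ)) (known final : List ℕ), (∀ s ∈ steps, s.1 < K) →
      C.peel gen known steps = some final → (∀ j ∈ known, F j = exprSum C F j) →
      ∀ j ∈ final, F j = exprSum C F j := by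
  intro steps
  induction steps with
  | nil =>
    intro known final _ h hknown
    simp only [Cert.peel, Option.some.injEq] at h
    subst h
    exact hknown
  | cons s steps ih =>
    intro known final hK h hknown
    obtain ⟨code, j⟩ := s
    simp only [Cert.peel] at h
    split_ifs at h with hstep
    have hj : F j = exprSum C F j :=
      expressed_of_stepOK C F known (gen code) j hstep hknown (hF code (hK (code, j) (by simp)))
    refine ih (j :: known) final (fun s hs => hK s (by simp [hs])) h ?_
    intro j' hj'
    rcases List.mem_cons.mp hj' with rfl | hj'
    · exact hj
    · exact hknown j' hj'

/-- `(List.range n).map`-sums are `Finset.range` sums. [folklore] -/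
theorem list_range_map_sum {α : Type*} [AddCommMonoid α] (n : ℕ) (g : ℕ → α) :
    ((List.range n).map g).sum = ∑ i ∈ Finset.range n, g i := by
  rw [Finset.sum_eq_multiset_sum, Finset.range_val, Multiset.range, Multiset.map_coe, Multiset.sum_coe]

/-- **Soundness of the certificate.** If `check gen K X φ C = true` then every real solution of the pool
`gen 0, …, gen (K-1)` is a real multiple of `φ` on `{0, …, X-1}`. [cite: CremonaAlgorithms1997, §2.5] -/
theorem exists_eq_smul_of_check (K X : ℕ) (φ : ℕ → ℤ) (hcheck : C.check gen K X φ = true)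
    (F : ℕ → ℝ) (hF : ∀ k < K, eval F (gen k) = 0) :
    ∃ t : ℝ, ∀ i < X, F i = t * φ i := by
  -- unpack the check
  simp only [Cert.check, Bool.and_eq_true, decide_eq_true_eq, List.all_eq_true, List.mem_range,
    beq_iff_eq, bne_iff_ne, ne_eq] at hcheck
  obtain ⟨⟨⟨⟨⟨⟨⟨⟨⟨⟨hm, hq⟩, hlen⟩, hcorelen⟩, hunit⟩, hstepsK⟩, hcoreK⟩, hpeel⟩, hmat⟩, hφ⟩, hφ0⟩ :=
    hcheck
  -- the peeling result
  cases hp : C.peel gen C.core C.steps with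
  | none => simp [hp] at hpeel
  | some final =>
    simp only [hp, Bool.and_eq_true, List.all_eq_true, List.mem_range, decide_eq_true_eq] at hpeel
    obtain ⟨hcover, hcoreKnown⟩ := hpeel
    -- the comparison solution `G = F - t φ`
    set t : ℝ := F (C.cr 0) / (φ (C.cr 0) : ℝ) with ht
    set G : ℕ → ℝ := fun i => F i - t * (φ i : ℝ) with hG
    have hφR : ∀ k < K, eval (fun j => (φ j : ℝ)) (gen k) = 0 := fun k hk => by
      rw [eval_intCast, hφ k hk]; simp
    have hGsol : ∀ k < K, eval G (gen k) = 0 := fun k hk => by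
      rw [hG, eval_sub_smul, hF k hk, hφR k hk]; simp
    have hG0 : G (C.cr 0) = 0 := by
      have hφ0' : (φ (C.cr 0) : ℝ) ≠ 0 := by exact_mod_cast hφ0
      simp only [hG, ht]
      field_simp
      ring
    -- core unknowns are expressed (unit vectors)
    have hcoreExpr : ∀ j ∈ C.core, G j = exprSum C G j := by
      intro j hj
      obtain ⟨k, hk, rfl⟩ := List.getElem_of_mem hj
      have hk' : C.cr k = C.core[k] := by simp [Cert.cr, List.getD_eq_getElem?_getD, hk]
      rw [exprSum, ← hk', Finset.sum_eq_single k]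
      · rw [hunit k (by omega) k (by omega)]; simp
      · intro k' hk'm hne
        rw [hunit k (by omega) k' (Finset.mem_range.mp hk'm), if_neg (Ne.symm hne)]; simp
      · intro hk; exact absurd (Finset.mem_range.mpr (by omega)) hk
    -- all finally known unknowns are expressed
    have hall : ∀ j ∈ final, G j = exprSum C G j :=
      expressed_of_peel C gen G K hGsol C.steps C.core final hstepsK hp hcoreExpr
    -- the core system `A' y = 0`
    set n := C.m - 1 with hn
    let A : Matrix (Fin n) (Fin n) ℤ := fun r s => C.aEntry gen r s
    let y : Fin n → ℝ := fun s => G (C.cr (s + 1))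
    have hAy : (A.map (Int.castRingHom ℝ)).mulVec y = 0 := by
      ext r
      simp only [Matrix.mulVec, dotProduct, Matrix.map_apply, eq_intCast, Pi.zero_apply]
      -- core equation r
      have hr : (r : ℕ) < C.coreEqs.length := by rw [hlen]; exact r.2
      have hcode : C.coreEqs.getD r 0 = C.coreEqs[(r : ℕ)] := by
        simp [List.getD_eq_getElem?_getD, hr]
      have hmem : C.coreEqs[(r : ℕ)] ∈ C.coreEqs := List.getElem_mem hr
      have hsol := hGsol (C.coreEqs.getD r 0) (by rw [hcode]; exact hcoreK _ hmem)
      have hexpr : ∀ jc ∈ gen (C.coreEqs.getD r 0), G jc.1 = exprSum C G jc.1 := fun jc hjc =>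
        hall _ (hcoreKnown _ (by rw [hcode]; exact hmem) jc hjc)
      rw [eval_eq_sum_comb C G _ hexpr] at hsol
      -- drop the k = 0 term (G c₀ = 0) and shift
      rw [show C.m = n + 1 by omega, Finset.sum_range_succ'] at hsol
      rw [hG0, mul_zero, add_zero] at hsol
      rw [← hsol, Finset.sum_range (fun i => (C.comb (gen (C.coreEqs.getD r 0)) (i + 1) : ℝ) * G (C.cr (i + 1)))]
      rfl
    -- `det A ≠ 0` from `A B ≡ 1 mod q`
    haveI : Fact (1 < C.q) := ⟨hq⟩
    have hdet : A.det ≠ 0 := by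
      intro h0
      let Aq : Matrix (Fin n) (Fin n) (ZMod C.q) := A.map (Int.castRingHom (ZMod C.q))
      let Bq : Matrix (Fin n) (Fin n) (ZMod C.q) := fun t s => ((C.bEntry t s : ℤ) : ZMod C.q)
      have hAB : Aq * Bq = 1 := by
        ext r s
        have h := hmat r r.2 s s.2
        have hsum : C.abEntry gen r s = ∑ t : Fin n, A r t * C.bEntry t s := by
          rw [Cert.abEntry, list_range_map_sum, ← Fin.sum_univ_eq_sum_range]
        have hcast : ((C.abEntry gen r s : ℤ) : ZMod C.q) = if (r : ℕ) = s then 1 else 0 := by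
          rw [← ZMod.intCast_mod, h]
          split_ifs <;> simp
        have e1 : (Aq * Bq) r s = ((∑ t : Fin n, A r t * C.bEntry t s : ℤ) : ZMod C.q) := by
          rw [Matrix.mul_apply]
          push_cast
          simp only [Aq, Bq, Matrix.map_apply, eq_intCast]
        rw [e1, ← hsum, hcast, Matrix.one_apply]
        by_cases hrs : r = s
        · simp [hrs]
        · simp [hrs, Fin.val_inj.not.mpr hrs]
      have hu : IsUnit Aq.det := Matrix.isUnit_det_of_right_inverse hAB
      have hdq : Aq.det = ((A.det : ℤ) : ZMod C.q) := by
        simp only [Aq]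
        rw [← RingHom.mapMatrix_apply, ← RingHom.map_det]; simp
      rw [hdq, h0, Int.cast_zero] at hu
      exact not_isUnit_zero hu
    have hdetR : (A.map (Int.castRingHom ℝ)).det ≠ 0 := by
      rw [← RingHom.mapMatrix_apply, ← RingHom.map_det]
      simpa using hdet
    have hy : y = 0 := Matrix.eq_zero_of_mulVec_eq_zero hdetR hAy
    -- all core values vanish
    have hcore0 : ∀ k < C.m, G (C.cr k) = 0 := by
      intro k hk
      rcases k with _ | k
      · exact hG0
      · have := congrFun hy ⟨k, by omega⟩
        simpa [y] using this
    -- conclude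
    refine ⟨t, fun i hi => ?_⟩
    have hGi : G i = 0 := by
      rw [hall i (hcover i hi), exprSum]
      exact Finset.sum_eq_zero fun k hk => by rw [hcore0 k (Finset.mem_range.mp hk), mul_zero]
    have : F i - t * (φ i : ℝ) = 0 := hGi
    linarith

end Sound

end Summit.BirchSwinnertonDyer.BirchSwinnertonDyer.Theorems.KolyvaginDepthDoor.MSymbolCert
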